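import Summits.Ventures.CertifiedManyBodySolver.Upper.StripCellStructureTTPrime
import Summits.Ventures.CertifiedManyBodySolver.Theorems.R2cStripCellSpinSectors
import HarnessLib

/-!
# Route `R2cOpenStripTangentLine` — the `t′`-GENERAL strip-cell consumer, part 1/2: dart counts, the producer-free
# Loewner bound of `stripCellBondMatrixTT'`, and the strip-cell family's energy at `t′ ≠ 0`

HONEST FRAMING: first certified bounds; not a superconductivity verdict; every number certified or labelled float.
NO NUMBER IS CLAIMED HERE: every theorem is producer-free structure or an implication from a certificate's data.

Venture `Ventures/CertifiedManyBodySolver` (sr-mbsolver), the `t′`-general strip-cell transport theorem (VAR r211 item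
V13; lit-4 typing fact: `energyDensityTT'_le_of_exists_stripCellCert₂` types bare `bd-strip-cell-v1` certificates at
`t′ = 0` only), PART 5a (parts 1–4 under `Upper/`: `StripCellsDiag`, `StripCellWordsDiag`, `StripCellHamiltonianTTPrime`,
`StripCellStructureTTPrime`). This file is the `t′`-twin of `Theorems/R2cStripCellSectorConsumers.lean` §R and of the
family lemmas of `Theorems/R2cStripCellConsumer.lean` / `R2cStripCellEnergyDensity.lean`:

* `sum_sum_ite_rectBoxDiagGraph_adj` — the diagonal dart count of the open `c × W` box, `4(c−1)(W−1)`;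
  `card_adjRowPairs` — `2(W−1)` inter-cell diagonal bonds; **`stripCellRowBoundTT'_eq`** — the closed form
  `γ₀(t,t′,U) = |t|·(4((c−1)W + c(W−1)) + 4W) + |t′|·(8(c−1)(W−1) + 8(W−1)) + |U|·cW`;
* **`stripCellBondMatrixTT'_loewner`** — `γ·1 ∓ hh ⪰ 0` for `γ ≥ stripCellRowBoundTT'` (Geršgorin on the Hermitian `hh`);
* `stripCell_family_energy_le_TT'`, **`stripCell_family_fock_TT'`** — for `k ≥ 1` cells the boundary-propagated mixture
  `φ_a = (mpsOpen k A e_a r) ∘ superCfg` on the open `(k·c) × W` box has norm `1`, energy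
  `⟨H_open(t,t′,U)⟩ ≤ (k−1)·c_cert + 2|z| + K` and particle number `k·Q_c ± (qmax − qmin)` — the `t′ = 0` proofs
  verbatim with `superOp_toSpin_hubbardOpenBoxTT'_TT'` / `…_eq_bondSum_TT'` and `stripCellBondMatrixTT'`.

Part 5b (`Theorems/R2cStripCellTTPrimeEnergyDensity.lean`): the row-makers and the claim-node packaging
`energyDensityTT'_le_of_exists_stripCellCertTT'`. Sources: VAR `METHOD-umps.md` Thm U1; Horn–Johnson (2013) Thm. 6.1.1
[HornJohnson2013]; Ruelle (1969) §3.4 [Ruelle1969]; Fannes–Nachtergaele–Werner (1992) [FannesNachtergaeleWernerCMP1992].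
-/

noncomputable section

open Matrix Finset
open scoped ComplexOrder BigOperators Kronecker

namespace Summit.Ventures.CertifiedManyBodySolver.Theorems

open Literature.MathematicalPhysics.QuantumLattice
open Literature.MathematicalPhysics.QuantumLattice.JordanWigner
open Literature.LinearAlgebra.Matrix.PolarOrthonormalization
open Summit.Ventures.CertifiedManyBodySolver.Upper

/-! ### Part R — dart counts and the closed form of the row-sum constant -/

section DartCount

/-- **The diagonal dart count of the open `c × W` box**: `#{(f, f') : f, f' diagonal neighbours} = 4(c−1)(W−1)`
(ordered pairs; `2(c−1)(W−1)` diagonal bonds). [folklore] -/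
theorem sum_sum_ite_rectBoxDiagGraph_adj (c W : ℕ) :
    (∑ f : Fin c ×ₗ Fin W, ∑ f' : Fin c ×ₗ Fin W, if (rectBoxDiagGraph c W).Adj f f' then (1 : ℕ) else 0) =
      4 * ((c - 1) * (W - 1)) := by
  have hLex : (∑ f : Fin c ×ₗ Fin W, ∑ f' : Fin c ×ₗ Fin W,
      if (rectBoxDiagGraph c W).Adj f f' then (1 : ℕ) else 0) =
      ∑ x : Fin c × Fin W, ∑ x' : Fin c × Fin W,
        if (rectBoxDiagGraph c W).Adj (toLex x) (toLex x') then (1 : ℕ) else 0 := by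
    rw [← (toLex : Fin c × Fin W ≃ Fin c ×ₗ Fin W).sum_comp]
    refine Finset.sum_congr rfl fun x _ => ?_
    rw [← (toLex : Fin c × Fin W ≃ Fin c ×ₗ Fin W).sum_comp]
  rw [hLex]
  have hsplit : ∀ x x' : Fin c × Fin W,
      (if (rectBoxDiagGraph c W).Adj (toLex x) (toLex x') then (1 : ℕ) else 0) =
        (if lineAdj (x.1 : ℕ) x'.1 then 1 else 0) * (if lineAdj (x.2 : ℕ) x'.2 then 1 else 0) := by
    intro x x'
    by_cases hA : lineAdj (x.1 : ℕ) x'.1 <;> by_cases hB : lineAdj (x.2 : ℕ) x'.2 <;>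
      simp [rectBoxDiagGraph, hA, hB]
  simp_rw [hsplit, Fintype.sum_prod_type]
  have key : ∀ i : Fin c, (∑ j : Fin W, ∑ i' : Fin c, ∑ j' : Fin W,
      (if lineAdj (i : ℕ) i' then 1 else 0) * (if lineAdj (j : ℕ) j' then (1 : ℕ) else 0)) =
      (∑ i' : Fin c, if lineAdj (i : ℕ) i' then 1 else 0) *
        ∑ j : Fin W, ∑ j' : Fin W, if lineAdj (j : ℕ) j' then (1 : ℕ) else 0 := by
    intro i
    rw [Finset.sum_comm, Finset.sum_mul]
    refine Finset.sum_congr rfl fun i' _ => ?_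
    rw [Finset.mul_sum]
    refine Finset.sum_congr rfl fun j _ => ?_
    rw [Finset.mul_sum]
  simp_rw [key]
  rw [← Finset.sum_mul, sum_sum_ite_lineAdj, sum_sum_ite_lineAdj]
  ring

/-- **The inter-cell diagonal bond count**: `#adjRowPairs W = 2(W−1)`. [folklore] -/
theorem card_adjRowPairs (W : ℕ) : (adjRowPairs W).card = 2 * (W - 1) := by
  rw [adjRowPairs, Finset.card_filter, Fintype.sum_prod_type]
  exact sum_sum_ite_lineAdj W

/-- **Closed form of the `t–t′` row-sum constant**:
`|t|·(4((c−1)W + c(W−1)) + 4W) + |t′|·(8(c−1)(W−1) + 8(W−1)) + |U|·cW` (natural-number subtraction inside the casts;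
at `(t, t′, U) = (1, ±3/10, 8)`, `c = W = 4`: `112 + (3/10)·96 + 128 = 1344/5`). [folklore] -/
theorem stripCellRowBoundTT'_eq (c W : ℕ) (t t' U : ℝ) :
    stripCellRowBoundTT' c W t t' U =
      |t| * (4 * (((c - 1) * W + c * (W - 1) : ℕ) : ℝ) + 4 * W) +
        |t'| * (8 * (((c - 1) * (W - 1) : ℕ) : ℝ) + 8 * ((W - 1 : ℕ) : ℝ)) + |U| * (c * W) := by
  have h2 : ∀ (G : SimpleGraph (Fin c ×ₗ Fin W)) [DecidableRel G.Adj],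
      (∑ f : Fin c ×ₗ Fin W, ∑ f' : Fin c ×ₗ Fin W, if G.Adj f f' then (2 : ℝ) else 0) =
      2 * ((∑ f : Fin c ×ₗ Fin W, ∑ f' : Fin c ×ₗ Fin W, if G.Adj f f' then (1 : ℕ) else 0 : ℕ) : ℝ) := by
    intro G _
    push_cast
    rw [Finset.mul_sum]
    refine Finset.sum_congr rfl fun f _ => ?_
    rw [Finset.mul_sum]
    refine Finset.sum_congr rfl fun f' _ => ?_
    split_ifs <;> norm_num
  unfold stripCellRowBoundTT'
  rw [h2, h2, sum_sum_ite_rectBoxGraph_adj, sum_sum_ite_rectBoxDiagGraph_adj, card_adjRowPairs]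
  push_cast
  ring

/-- By-value sanity (c = W = 4, (t, t′, U) = (1, 3/10, 8)): the constant is `112 + 96·(3/10) + 128 = 1344/5`
(eng-1's `norm_intra + norm_inter` at t′ = ±3/10; `240` at t′ = 0). -/
example : stripCellRowBoundTT' 4 4 1 (3 / 10) 8 = 1344 / 5 := by
  rw [stripCellRowBoundTT'_eq]; norm_num

end DartCount

/-! ### Part R — the Loewner bound of the `t–t′` cell bond matrix (Geršgorin) -/

section Loewner

variable {c W Q : ℕ}

/-- **PRODUCER-FREE LOEWNER BOUND of the `t–t′` strip cell bond matrix** (Geršgorin on a Hermitian matrix with row sums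
`≤ γ`): `γ·1 − hh ⪰ 0` and `γ·1 + hh ⪰ 0` for every `γ ≥ stripCellRowBoundTT' c W t t' U` — the inputs `hX₁`, `hX₂` of the
dyadic row-makers. [cite: HornJohnson2013, Thm. 6.1.1] -/
theorem stripCellBondMatrixTT'_loewner (κ : TensorIndex (Fin c ×ₗ Fin W) 4 ≃ Fin Q) (hc : 0 < c) (t t' U : ℝ)
    {γ : ℝ} (hγ : stripCellRowBoundTT' c W t t' U ≤ γ) :
    (((γ : ℂ)) • (1 : Matrix (Fin Q × Fin Q) (Fin Q × Fin Q) ℂ) - stripCellBondMatrixTT' κ hc t t' U).PosSemidef ∧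
      (((γ : ℂ)) • (1 : Matrix (Fin Q × Fin Q) (Fin Q × Fin Q) ℂ) +
        stripCellBondMatrixTT' κ hc t t' U).PosSemidef := by
  have hX : ∀ p, ∑ p', ‖stripCellBondMatrixTT' κ hc t t' U p p'‖ ≤ γ :=
    fun p => (stripCellBondMatrixTT'_rowSum_le κ hc t t' U p).trans hγ
  have hXh := stripCellBondMatrixTT'_isHermitian κ hc t t' U
  refine ⟨Matrix.le_iff.mp (le_smul_one_of_rowSum_le hXh hX), ?_⟩
  have h := Matrix.le_iff.mp (neg_smul_one_le_of_rowSum_le hXh hX)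
  rwa [sub_neg_eq_add, add_comm] at h

end Loewner

/-! ### The strip-cell family at `t′ ≠ 0`: energy and the Fock-space read-back -/

section Family

variable {W c Q D : ℕ}

/-- **Energy of the family at `(t, t′, U)`** (METHOD-umps U1 on the `t–t′` strip, `k ≥ 1` cells): with
`c_cert·1 − W(A; hh, Z) ⪰ 0` for `hh = stripCellBondMatrixTT' κ hc t t' U`, `z·1 ∓ Z ⪰ 0`, `‖r‖ = 1`, and
`K·1 − superSite κ (toSpin H_open(c × W; t, t′, U)) ⪰ 0`:
`Σ_a Re⟨φ_a, toSpin H_open((k·c) × W; t, t′, U) φ_a⟩ ≤ (k − 1)·c_cert + 2|z| + K`. -/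
theorem stripCell_family_energy_le_TT' (hc : 0 < c) (κ : TensorIndex (Fin c ×ₗ Fin W) 4 ≃ Fin Q)
    {A : MPSTensor Q D} (hA : ∑ S, (A S)ᴴ * A S = 1) {r : Fin D → ℂ} (hr : star r ⬝ᵥ r = 1)
    (Z : Matrix (Fin D) (Fin D) ℂ) (t t' : ℝ) {U cc z K : ℝ}
    (hdual : (((cc : ℝ) : ℂ) • (1 : Matrix (Fin D) (Fin D) ℂ) -
      dualMatrix A (stripCellBondMatrixTT' κ hc t t' U) Z).PosSemidef)
    (hZ₁ : (((z : ℝ) : ℂ) • (1 : Matrix (Fin D) (Fin D) ℂ) - Z).PosSemidef)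
    (hZ₂ : (((z : ℝ) : ℂ) • (1 : Matrix (Fin D) (Fin D) ℂ) + Z).PosSemidef)
    (hK : (((K : ℝ) : ℂ) • (1 : Matrix (Fin Q) (Fin Q) ℂ) -
      superSite κ (toSpin (hubbardOpenBoxTT' c W t t' U))).PosSemidef)
    (k : ℕ) (hk : 1 ≤ k) :
    ∑ l : Fin D, (star (fun σ => mpsOpen k A (Pi.single l 1) r (superCfg (stripCells k c W) κ σ)) ⬝ᵥ
        (toSpin (hubbardOpenBoxTT' (k * c) W t t' U) *ᵥ
          fun σ => mpsOpen k A (Pi.single l 1) r (superCfg (stripCells k c W) κ σ))).re ≤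
      ((k : ℝ) - 1) * cc + 2 * |z| + K := by
  -- the last-cell one-site operator is bounded by `K`
  have hlast : ∀ (C : ℕ) (b : Fin C), (((K : ℝ) : ℂ) • (1 : Op (Fin C) Q) -
      onSite b (superSite κ (toSpin (hubbardOpenBoxTT' c W t t' U)))).PosSemidef := by
    intro C b
    have h : (((K : ℝ) : ℂ) • (1 : Op (Fin C) Q) -
        onSite b (superSite κ (toSpin (hubbardOpenBoxTT' c W t t' U)))) =
        onSite b ((((K : ℝ) : ℂ) • (1 : Matrix (Fin Q) (Fin Q) ℂ) -
          superSite κ (toSpin (hubbardOpenBoxTT' c W t t' U)))) := by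
      rw [onSite_sub', onSite_smul', onSite_one']
    rw [h]
    exact onSite_posSemidef b hK
  have hz0 : z ≤ |z| := le_abs_self z
  simp only [star_comp_superCfg_dotProduct_mulVec]
  rcases (show k = 1 ∨ ∃ n, k = n + 2 by
      rcases k with _ | _ | n <;> [omega; exact Or.inl rfl; exact Or.inr ⟨n, rfl⟩]) with rfl | ⟨n, rfl⟩
  · -- one cell: only the last-cell term
    rw [superOp_toSpin_hubbardOpenBoxTT'_TT' hc κ t t' U]
    simp only [Fin.sum_univ_one, Fin.val_zero, zero_add, one_ne_zero, if_false, smul_zero, add_zero]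
    have h1 : ∀ l : Fin D, (star (mpsOpen 1 A (Pi.single l 1) r) ⬝ᵥ
        (onSite (0 : Fin 1) (superSite κ (toSpin (hubbardOpenBoxTT' c W t t' U))) *ᵥ
          mpsOpen 1 A (Pi.single l 1) r)).re ≤ K * (star (mpsOpen 1 A (Pi.single l 1) r) ⬝ᵥ
            mpsOpen 1 A (Pi.single l 1) r).re := fun l =>
      re_star_dotProduct_mulVec_le_of_posSemidef (hlast 1 0) _
    have h2 : ∑ l : Fin D, (star (mpsOpen 1 A (Pi.single l 1) r) ⬝ᵥ mpsOpen 1 A (Pi.single l 1) r).re = 1 := by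
      rw [← Complex.re_sum, sum_star_mpsOpen_dotProduct_mpsOpen_eq hA 1 r, hr, Complex.one_re]
    calc ∑ l : Fin D, (star (mpsOpen 1 A (Pi.single l 1) r) ⬝ᵥ
          (onSite (0 : Fin 1) (superSite κ (toSpin (hubbardOpenBoxTT' c W t t' U))) *ᵥ
            mpsOpen 1 A (Pi.single l 1) r)).re
        ≤ ∑ l : Fin D, K * (star (mpsOpen 1 A (Pi.single l 1) r) ⬝ᵥ mpsOpen 1 A (Pi.single l 1) r).re :=
          Finset.sum_le_sum fun l _ => h1 l
      _ = K := by rw [← Finset.mul_sum, h2, mul_one]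
      _ ≤ (((1 : ℕ) : ℝ) - 1) * cc + 2 * |z| + K := by push_cast; nlinarith [abs_nonneg z]
  · -- `n + 2` cells: the bond sum (tensor side) and the last cell
    rw [superOp_toSpin_hubbardOpenBoxTT'_eq_bondSum_TT' n hc κ t t' U]
    simp only [Matrix.add_mulVec, dotProduct_add, Complex.add_re, Finset.sum_add_distrib]
    have hB := re_sum_star_mpsOpen_dotProduct_bondSum_mulVec_le hA hr (stripCellBondMatrixTT' κ hc t t' U) Z
      hdual hZ₁ hZ₂ n
    rw [Complex.re_sum] at hB
    have h1 : ∀ l : Fin D, (star (mpsOpen (n + 2) A (Pi.single l 1) r) ⬝ᵥ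
        (onSite (Fin.last (n + 1)) (superSite κ (toSpin (hubbardOpenBoxTT' c W t t' U))) *ᵥ
          mpsOpen (n + 2) A (Pi.single l 1) r)).re ≤ K * (star (mpsOpen (n + 2) A (Pi.single l 1) r) ⬝ᵥ
            mpsOpen (n + 2) A (Pi.single l 1) r).re := fun l =>
      re_star_dotProduct_mulVec_le_of_posSemidef (hlast (n + 2) (Fin.last (n + 1))) _
    have h2 : ∑ l : Fin D, (star (mpsOpen (n + 2) A (Pi.single l 1) r) ⬝ᵥ
        mpsOpen (n + 2) A (Pi.single l 1) r).re = 1 := by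
      rw [← Complex.re_sum, sum_star_mpsOpen_dotProduct_mpsOpen_eq hA (n + 2) r, hr, Complex.one_re]
    have hL : ∑ l : Fin D, (star (mpsOpen (n + 2) A (Pi.single l 1) r) ⬝ᵥ
        (onSite (Fin.last (n + 1)) (superSite κ (toSpin (hubbardOpenBoxTT' c W t t' U))) *ᵥ
          mpsOpen (n + 2) A (Pi.single l 1) r)).re ≤ K :=
      calc _ ≤ ∑ l : Fin D, K * (star (mpsOpen (n + 2) A (Pi.single l 1) r) ⬝ᵥ
              mpsOpen (n + 2) A (Pi.single l 1) r).re := Finset.sum_le_sum fun l _ => h1 l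
        _ = K := by rw [← Finset.mul_sum, h2, mul_one]
    push_cast
    nlinarith [hB, hL, hz0]

/-- **The strip-cell family on Fock space at `(t, t′, U)`.** For `k ≥ 1` cells, the Jordan–Wigner preimages
`ψ_a = toSpinVec⁻¹ ((mpsOpen k A e_a r) ∘ superCfg)` of the boundary-propagated mixture on the open `(k·c) × W` box
have total norm `1`, energy `⟨H_open(t,t′,U)⟩ ≤ (k−1)·c_cert + 2|z| + K` and particle number within
`k·Q_c ± (qmax − qmin)`. -/
theorem stripCell_family_fock_TT' (hc : 0 < c) (κ : TensorIndex (Fin c ×ₗ Fin W) 4 ≃ Fin Q)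
    {A : MPSTensor Q D} (hA : ∑ S, (A S)ᴴ * A S = 1) {r : Fin D → ℂ} (hr : star r ⬝ᵥ r = 1)
    (Z : Matrix (Fin D) (Fin D) ℂ) (t t' : ℝ) {U cc z K : ℝ}
    (hdual : (((cc : ℝ) : ℂ) • (1 : Matrix (Fin D) (Fin D) ℂ) -
      dualMatrix A (stripCellBondMatrixTT' κ hc t t' U) Z).PosSemidef)
    (hZ₁ : (((z : ℝ) : ℂ) • (1 : Matrix (Fin D) (Fin D) ℂ) - Z).PosSemidef)
    (hZ₂ : (((z : ℝ) : ℂ) • (1 : Matrix (Fin D) (Fin D) ℂ) + Z).PosSemidef)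
    (hK : (((K : ℝ) : ℂ) • (1 : Matrix (Fin Q) (Fin Q) ℂ) -
      superSite κ (toSpin (hubbardOpenBoxTT' c W t t' U))).PosSemidef)
    (lab : Fin D → ℤ) (Qc : ℤ)
    (hBC : ∀ (S : Fin Q) (α β : Fin D), A S α β ≠ 0 →
      lab β + Qc = lab α + ((∑ f, siteCharge (κ.symm S f) : ℕ) : ℤ))
    {qmin qmax : ℤ} (hlab : ∀ α, qmin ≤ lab α ∧ lab α ≤ qmax) (k : ℕ) (hk : 1 ≤ k) :
    let ψ : Fin D → Fock (Orb (Fin (k * c) ×ₗ Fin W)) := fun l =>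
      toSpinVec.symm (fun σ => mpsOpen k A (Pi.single l 1) r (superCfg (stripCells k c W) κ σ))
    (∑ l, (star (ψ l) ⬝ᵥ ψ l).re = 1) ∧
      (∑ l, (star (ψ l) ⬝ᵥ (hubbardOpenBoxTT' (k * c) W t t' U *ᵥ ψ l)).re ≤
        ((k : ℝ) - 1) * cc + 2 * |z| + K) ∧
      ((k : ℝ) * ((Qc : ℤ) : ℝ) - (((qmax : ℤ) : ℝ) - ((qmin : ℤ) : ℝ)) ≤
          ∑ l, (star (ψ l) ⬝ᵥ (totalNumber *ᵥ ψ l)).re) ∧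
      (∑ l, (star (ψ l) ⬝ᵥ (totalNumber *ᵥ ψ l)).re ≤
          (k : ℝ) * ((Qc : ℤ) : ℝ) + (((qmax : ℤ) : ℝ) - ((qmin : ℤ) : ℝ))) := by
  intro ψ
  -- Jordan–Wigner: the three quadratic forms read on the spin side
  have hn : ∀ l, star (ψ l) ⬝ᵥ ψ l =
      star (fun σ => mpsOpen k A (Pi.single l 1) r (superCfg (stripCells k c W) κ σ)) ⬝ᵥ
        (fun σ => mpsOpen k A (Pi.single l 1) r (superCfg (stripCells k c W) κ σ)) := fun l => by
    rw [← star_toSpinVec_dotProduct, LinearEquiv.apply_symm_apply]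
  have hH : ∀ l, star (ψ l) ⬝ᵥ (hubbardOpenBoxTT' (k * c) W t t' U *ᵥ ψ l) =
      star (fun σ => mpsOpen k A (Pi.single l 1) r (superCfg (stripCells k c W) κ σ)) ⬝ᵥ
        (toSpin (hubbardOpenBoxTT' (k * c) W t t' U) *ᵥ
          fun σ => mpsOpen k A (Pi.single l 1) r (superCfg (stripCells k c W) κ σ)) := fun l => by
    have h := expect_eq (hubbardOpenBoxTT' (k * c) W t t' U) (ψ l)
    rwa [Literature.MathematicalPhysics.QuantumLattice.expect, LinearEquiv.apply_symm_apply] at h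
  have hN : ∀ l, star (ψ l) ⬝ᵥ (totalNumber *ᵥ ψ l) =
      star (fun σ => mpsOpen k A (Pi.single l 1) r (superCfg (stripCells k c W) κ σ)) ⬝ᵥ
        ((∑ x : Fin (k * c) ×ₗ Fin W, onSite x siteTotalNumber) *ᵥ
          fun σ => mpsOpen k A (Pi.single l 1) r (superCfg (stripCells k c W) κ σ)) := fun l => by
    have h := expect_eq (totalNumber (Λ := Fin (k * c) ×ₗ Fin W)) (ψ l)
    rwa [Literature.MathematicalPhysics.QuantumLattice.expect, LinearEquiv.apply_symm_apply,
      toSpin_totalNumber] at h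
  simp only [hn, hH, hN]
  refine ⟨?_, stripCell_family_energy_le_TT' hc κ hA hr Z t t' hdual hZ₁ hZ₂ hK k hk,
    (stripCell_family_number_mem κ hA hr lab Qc hBC hlab k).1,
    (stripCell_family_number_mem κ hA hr lab Qc hBC hlab k).2⟩
  rw [← Complex.re_sum, stripCell_family_norm κ hA r k, hr, Complex.one_re]

end Family

end Summit.Ventures.CertifiedManyBodySolver.Theorems

end
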